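import Summits.ResolutionOfSingularities.ResolutionOfSingularities.Theorems.FrobeniusClosingPatchingRelPerfectDepthWeightTwoBPieces
import Summits.ResolutionOfSingularities.ResolutionOfSingularities.Theorems.FrobeniusClosingPatchingRelPerfectDepthWeightTwoBStepLaw
import Summits.ResolutionOfSingularities.ResolutionOfSingularities.Theorems.FrobeniusClosingPatchingRelPerfectDepthWeightTwoBJoint
import Literature.AlgebraicGeometry.Resolution.CartierDivisorControlledTransform
import HarnessLib

/-!
# Crux `PatchingRelPerfect` (stmt-ResolutionOfSingularities-16161), chain W5.2 — TargetsF5J T5-E «W₂B-maxweight»: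
# the SINGLE-PIECE STEP — every hypothesis of `IsWeightedSeqJ.cons` (F5J v5.1) at one irreducible centre piece, from the
# transport invariant

[OURS · L1 W5.2 · TargetsF5J T5-E] Fact-free; NOT statements of the manuscript under review. The E-side transport of T5-E carries
along the CJS sequence the state `𝔟 = D · monomialIdeal ℬ` (reduced effective Cartier host `D` with no boundary component, boundary
exponent list `ℬ` with simple normal crossings, N-exponent list `𝒟` over the same sheaves) and the pointwise invariant (J#) «at every
point of the host lying on an N-charged member, the host and the charged members through it are snc». `PieceIn` packages this state
together with ONE irreducible piece `Z = cl{η}` of a CJS centre (`V(𝓘(Z))` regular, `Z ⊆ Supp D`, the boundary snc with `𝓘(Z)` —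
res-type-019's P3 read piecewise — and the CJS permissibility at the points of `Z` when the piece is weight-deficient). `pieceStep_clauses`
derives, for a blow-up `τ` along `𝓘(Z)`, the hypotheses of `IsWeightedSeqJ.cons` in their v5.1 order: connected regular centre,
`1 ≤ ν ≤ 2` with `ν = pieceWeight 𝔟 Z`, `𝔟 ≤ 𝓘(Z)^ν`, `D ≤ 𝓘(Z)^m` with `m = ord_η D`, `ν ≤ m + w`, uniform incidence of `ℬ` and `𝒟`,
the JOINT clause at the required points (cases A/B of `…DepthWeightTwoBJoint`), the pointwise max-weight clause, and «the carried host
does not become the exceptional divisor». (The two remaining clauses — blow-up existence and «the carried host is contained in no strict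
transform of a member» — and the re-establishment of the invariant on the blown-up scheme are the companion file `…PieceStepOut`.)

AI-written; AI review is weaker than expert review.

## References
* E. Bierstone, D. Grigoriev, P. Milman, J. Włodarczyk, arXiv:1206.3090, Def. 3.1.3, §3.2 Lemma 3.2.1, §4 Step 2a.
  [BierstoneGrigorievMilmanWlodarczyk2011]
* V. Cossart, U. Jannsen, S. Saito, LNM 2270 (2020), Thm. 1.4, Def. 3.1, Def. 4.1, (6.2). [CossartJannsenSaito2020]
* J. Kollár, *Lectures on Resolution of Singularities* (2007), 3.30.2, (3.111) Step 1. [Kollar2007]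
-/

-- `Summit.<Summit>.<Sub>.Theorems` with `Sub = Summit` (single-conjunct summit, D-0017)
set_option linter.dupNamespace false

noncomputable section

open CategoryTheory CategoryTheory.Limits AlgebraicGeometry TopologicalSpace IsLocalRing
open Literature.AlgebraicGeometry.Resolution Scheme.IdealSheafData
open Literature.AlgebraicGeometry.Hironaka2017.MonomialPart Literature.AlgebraicGeometry.Hironaka2017.MonomialComponent

namespace Summit.ResolutionOfSingularities.ResolutionOfSingularities.Theorems

universe u

namespace WeightTwoB

open DepthSNC

variable {W : Scheme.{u}}

/-- The list of CHARGED members (positive exponent) of `𝒟 ++ ℬ`, as in F5J's `JointStepAt`. [folklore] -/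
abbrev charged (ℬ 𝒟 : List (W.IdealSheafData × ℕ)) : List W.IdealSheafData :=
  ((𝒟 ++ ℬ).filter fun p => 0 < p.2).map Prod.fst

/-- Members of `charged ℬ 𝒟` are positively charged members of `𝒟` or of `ℬ`. [folklore] -/
theorem mem_charged_iff {ℬ 𝒟 : List (W.IdealSheafData × ℕ)} {B : W.IdealSheafData} :
    B ∈ charged ℬ 𝒟 ↔ ∃ c, 0 < c ∧ ((B, c) ∈ 𝒟 ∨ (B, c) ∈ ℬ) := by
  simp only [charged, List.mem_map, List.mem_filter, List.mem_append, Prod.exists, decide_eq_true_eq]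
  constructor
  · rintro ⟨B', c, ⟨h, hc⟩, rfl⟩
    exact ⟨c, hc, h⟩
  · rintro ⟨c, hc, h⟩
    exact ⟨B, c, ⟨h, hc⟩, rfl⟩

/-- [OURS · L1 W5.2] **The transport state of T5-E at one irreducible centre piece** (see the module docstring).
[cite: BierstoneGrigorievMilmanWlodarczyk2011, Def. 3.1.3] [cite: CossartJannsenSaito2020, (6.2), Def. 4.1] -/
structure PieceIn [IsLocallyNoetherian W] (𝔟 D : W.IdealSheafData) (ℬ 𝒟 : List (W.IdealSheafData × ℕ))
    (Z : Closeds W) (η : W) : Prop where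
  /-- the ambient scheme is regular -/
  regW : Scheme.IsRegular W
  /-- the factorisation host · boundary monomial -/
  fac : 𝔟 = D * monomialIdeal ℬ
  /-- the host is an effective Cartier divisor -/
  hostCartier : IsEffectiveCartier D
  /-- the boundary sheaves have simple normal crossings -/
  sncB : HasSNC (boundaryOf ℬ)
  /-- the N-exponent list lives on boundary sheaves -/
  sub𝒟 : ∀ p ∈ 𝒟, p.1 ∈ boundaryOf ℬ
  /-- (J#): at host points on an N-charged member, host and charged members are snc -/
  joint : ∀ x ∈ D.support, (∃ p ∈ 𝒟, 0 < p.2 ∧ x ∈ p.1.support) → SNCWithAt (D :: charged ℬ 𝒟) ⊤ x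
  /-- `η` is the generic point of the piece -/
  gen : IsGenericPoint η (Z : Set W)
  /-- the piece is a regular closed subscheme -/
  regZ : Scheme.IsRegular (vanishingIdeal Z).subscheme
  /-- the piece lies on the host -/
  subZ : (Z : Set W) ⊆ D.support
  /-- the boundary has simple normal crossings with the piece -/
  sncZ : HasSNCWith (boundaryOf ℬ) (vanishingIdeal Z)
  /-- CJS permissibility at the points of a weight-deficient piece (for the reduced zero-scheme of the host) -/
  perm : pieceWeight 𝔟 (Z : Set W) = 1 → ∀ z ∈ (Z : Set W),
    ((stalkIdeal (vanishingIdeal Z) z).map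
      (Ideal.Quotient.mk (stalkIdeal (vanishingIdeal D.support) z))).IsPermissible

namespace PieceIn

variable [IsLocallyNoetherian W] {𝔟 D : W.IdealSheafData} {ℬ 𝒟 : List (W.IdealSheafData × ℕ)} {Z : Closeds W} {η : W}
  (P : PieceIn 𝔟 D ℬ 𝒟 Z η)
include P

omit [IsLocallyNoetherian W] P in
/-- The support of the piece ideal is the piece. [folklore] -/
theorem support_eq : ((vanishingIdeal Z).support : Set W) = Z := Scheme.IdealSheafData.coe_support_vanishingIdeal Z

/-- `η` is the generic point of `V(𝓘(Z))`. [folklore] -/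
theorem gen' : IsGenericPoint η ((vanishingIdeal Z).support : Set W) := by rw [support_eq]; exact P.gen

/-- `η ∈ Z`. [folklore] -/
theorem η_mem : η ∈ (Z : Set W) := P.gen.mem

/-- The piece is connected (irreducible). [folklore] -/
theorem isPreconnected : _root_.IsPreconnected ((vanishingIdeal Z).support : Set W) := by
  rw [support_eq]; exact P.gen.isIrreducible.isPreirreducible.isPreconnected

/-- `𝔟 ≤ D`. [folklore] -/
theorem le_host : 𝔟 ≤ D := by
  rw [P.fac]
  exact Scheme.IdealSheafData.le_def.mpr fun U => by
    rw [Scheme.IdealSheafData.ideal_mul, Pi.mul_apply]; exact Ideal.mul_le_right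

/-- The piece lies in the support of `𝔟`. [folklore] -/
theorem subZ𝔟 : (Z : Set W) ⊆ 𝔟.support := fun _ hx => support_antitone P.le_host (P.subZ hx)

/-- PERMISSIBILITY `𝔟 ≤ 𝓘(Z)^ν`. [cite: BierstoneGrigorievMilmanWlodarczyk2011, Lemma 3.2.1 (1)] -/
theorem le_pow_weight : 𝔟 ≤ vanishingIdeal Z ^ pieceWeight 𝔟 (Z : Set W) :=
  le_vanishingIdeal_pow_pieceWeight P.regW P.regZ P.subZ𝔟

/-- The weight is admissible at the generic point: `ν ≤ ord_η 𝔟`. [folklore] -/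
theorem weight_le_idealOrder : (pieceWeight 𝔟 (Z : Set W) : ℕ∞) ≤ idealOrder 𝔟 η := by
  haveI := P.regW η
  have hle := P.le_pow_weight
  rw [le_idealOrder_iff]
  refine (stalkIdeal_mono hle η).trans ?_
  rw [stalkIdeal_pow]
  exact Ideal.pow_right_mono ((mem_support_iff_stalkIdeal_le _ η).mp (by rw [← SetLike.mem_coe, support_eq (Z := Z)]; exact P.η_mem)) _

/-- The host passes through `η` with some order `m ≥ 1`. [folklore] -/
theorem exists_idealOrder_host_eq : ∃ m : ℕ, idealOrder D η = m ∧ 1 ≤ m := by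
  haveI := P.regW η
  obtain ⟨g, hg0, hg⟩ := P.hostCartier.exists_stalkIdeal_eq_span η
  have hne : stalkIdeal D η ≠ ⊥ := by rw [hg]; simpa using nonZeroDivisors.ne_zero hg0
  have htop : idealOrder D η ≠ ⊤ := by
    intro h
    apply hne
    rw [eq_bot_iff, ← Ideal.iInf_pow_eq_bot_of_isLocalRing (I := maximalIdeal (W.presheaf.stalk η))
      (maximalIdeal.isMaximal _).ne_top]
    refine le_iInf fun r => (le_idealOrder_iff D η r).mp ?_
    rw [h]
    exact le_top
  obtain ⟨m, hm⟩ := ENat.ne_top_iff_exists.mp htop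
  refine ⟨m, hm.symm, ?_⟩
  have h1 : (1 : ℕ∞) ≤ idealOrder D η := (one_le_idealOrder_iff D η).mpr (P.subZ P.η_mem)
  rw [← hm] at h1
  exact_mod_cast h1

/-- `D ≤ 𝓘(Z)^m` for `m = ord_η D` (res-D-pv-026's (L-A)). [cite: BierstoneGrigorievMilmanWlodarczyk2011, Lemma 3.2.1 (1)] -/
theorem host_le_pow {m : ℕ} (hm : idealOrder D η = m) : D ≤ vanishingIdeal Z ^ m :=
  le_pow_of_idealOrder_genericPoint_eq P.regW P.regZ P.gen' hm

/-- The ADMISSIBILITY SPLIT `ν ≤ m + w`. [cite: BierstoneGrigorievMilmanWlodarczyk2011, §4 Step 2a] -/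
theorem weight_le_add {m : ℕ} (hm : idealOrder D η = m) (hm1 : 1 ≤ m) :
    pieceWeight 𝔟 (Z : Set W) ≤
      m + weightOf ℬ (divisorsOver ℬ (vanishingIdeal Z) (vanishingIdeal Z).support) := by
  rw [weightOf_divisorsOver_single_eq_weightAt ℬ P.gen]
  refine le_add_weightAt_of_le_two P.sncB (pieceWeight_le_two 𝔟 _) hm1 hm ?_
  rw [← P.fac]; exact P.weight_le_idealOrder

/-- UNIFORM INCIDENCE of `ℬ` and `𝒟` with the piece. [cite: Kollar2007, (3.111) Step 1] -/
theorem uniformPieces :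
    UniformPieces ℬ (vanishingIdeal Z) [(vanishingIdeal Z).support] ∧
      UniformPieces 𝒟 (vanishingIdeal Z) [(vanishingIdeal Z).support] :=
  ⟨uniformPieces_single_of_isGenericPoint ℬ P.gen, uniformPieces_single_of_isGenericPoint 𝒟 P.gen⟩

/-- The piece ideal's stalk at `z ∈ Z` is the prime of `η`. [folklore] -/
theorem stalkIdeal_centre_eq {z : W} (hz : z ∈ (Z : Set W)) :
    stalkIdeal (vanishingIdeal Z) z = primeOfSpecializes (P.gen.specializes hz) := by
  have hZ : Z = ⟨closure {η}, isClosed_closure⟩ := Closeds.ext P.gen.symm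
  subst hZ
  exact stalkIdeal_vanishingIdeal_closure (P.gen.specializes hz)

/-- The host contains the piece: `D ≤ 𝓘(Z)`, hence `D_z ≤ 𝓘(Z)_z`. [folklore] -/
theorem host_stalk_le (z : W) : stalkIdeal D z ≤ stalkIdeal (vanishingIdeal Z) z := by
  refine stalkIdeal_mono ?_ z
  exact Scheme.IdealSheafData.le_support_iff_le_vanishingIdeal.mp P.subZ

/-- At a weight-deficient piece: `ord_η 𝔟 ≤ 1` and `ord_η D ≤ 1`. [folklore] -/
theorem idealOrder_le_one_of_weight (h1 : pieceWeight 𝔟 (Z : Set W) = 1) :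
    idealOrder 𝔟 η ≤ 1 ∧ idealOrder D η ≤ 1 := by
  have h := idealOrder_genericPoint_le_one_of_pieceWeight_eq_one P.regW P.gen h1
  refine ⟨h, ?_⟩
  rw [P.fac] at h
  exact idealOrder_le_one_of_mul h

/-- **The JOINT clause** at a required point of the piece (cases A/B). [cite: Kollar2007, 3.104 Step 2.1] -/
theorem joint_clause {z : W} (hz : z ∈ (Z : Set W))
    (hreq : pieceWeight 𝔟 (Z : Set W) < 2 ∨ ∃ p ∈ 𝒟, 0 < p.2 ∧ z ∈ p.1.support) :
    stalkIdeal D z ≤ stalkIdeal (vanishingIdeal Z) z ∧ SNCWithAt (D :: charged ℬ 𝒟) (vanishingIdeal Z) z := by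
  haveI := P.regW z
  haveI := P.regW η
  refine ⟨P.host_stalk_le z, ?_⟩
  have hℬz : SNCWithAt (boundaryOf ℬ) (vanishingIdeal Z) z := P.sncZ.sncWithAt z
  by_cases hA : ∃ p ∈ 𝒟, 0 < p.2 ∧ z ∈ p.1.support
  · -- case A: tracked point
    refine sncWithAt_host_cons_of_tracked hℬz (P.joint z (P.subZ hz) hA) (P.host_stalk_le z) fun B hB => ?_
    obtain ⟨c, -, h | h⟩ := mem_charged_iff.mp hB
    · exact P.sub𝒟 _ h
    · exact fst_mem_boundaryOf h
  · -- case B: weight-one piece, no N-charged member through `z`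
    have h1 : pieceWeight 𝔟 (Z : Set W) = 1 := by
      rcases hreq with h | h
      · exact (pieceWeight_lt_two_iff 𝔟 _).mp h
      · exact absurd h hA
    obtain ⟨hord𝔟, hordD⟩ := P.idealOrder_le_one_of_weight h1
    have hηz := P.gen.specializes hz
    obtain ⟨h, hDz, hhC, hh2⟩ := exists_regular_host_generator P.hostCartier hηz (P.stalkIdeal_centre_eq hz)
      (by rw [P.stalkIdeal_centre_eq hz] at *; exact (P.stalkIdeal_centre_eq hz) ▸ P.perm h1 z hz) (P.subZ P.η_mem) hordD
    refine sncWithAt_host_cons_of_weightOne hηz (P.stalkIdeal_centre_eq hz) hℬz hDz hhC hh2 P.fac (P.subZ P.η_mem)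
      hord𝔟 fun B hB hzB => ?_
    obtain ⟨c, hc, h' | h'⟩ := mem_charged_iff.mp hB
    · exact absurd ⟨(B, c), h', hc, hzB⟩ hA
    · exact ⟨fst_mem_boundaryOf h', c, hc, h'⟩

/-- **The pointwise MAX-WEIGHT clause** at a weight-deficient piece. [folklore] -/
theorem maxWeight_clause (hlt : pieceWeight 𝔟 (Z : Set W) < 2) {z : W} (hz : z ∈ (Z : Set W)) :
    ¬ stalkIdeal 𝔟 z ≤ stalkIdeal (vanishingIdeal Z) z ^ (pieceWeight 𝔟 (Z : Set W) + 1) := by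
  have h1 : pieceWeight 𝔟 (Z : Set W) = 1 := (pieceWeight_lt_two_iff 𝔟 _).mp hlt
  rw [h1]
  exact not_stalkIdeal_le_centre_sq (P.gen.specializes hz) (P.stalkIdeal_centre_eq hz)
    (P.idealOrder_le_one_of_weight h1).1

/-- **The carried host does not become the exceptional divisor** (`m` is the generic order; res-D-pv-026's (L-A)).
[cite: Kollar2007, 3.30.2] -/
theorem not_host_le_exceptional {W' : Scheme.{u}} {τ : W' ⟶ W} (hτ : IsBlowup τ (vanishingIdeal Z)) {m : ℕ}
    (hm : idealOrder D η = m) :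
    ¬ controlledTransform τ (vanishingIdeal Z) D m ≤ (vanishingIdeal Z).comap τ := by
  haveI : IsLocallyNoetherian W' := hτ.isLocallyNoetherian
  intro hle
  have hint : interior (Z : Set W) = ∅ := by
    have h := interior_eq_empty_of_isGenericPoint_of_mem_support P.gen' P.hostCartier (P.subZ P.η_mem)
    rwa [support_eq (Z := Z)] at h
  -- a point of `W'` over the piece: the exceptional divisor is irreducible, in particular non-empty
  obtain ⟨x', hx'⟩ := (IsBlowup.isIrreducible_preimage_of_isRegular P.regW P.regZ P.gen.isIrreducible hint hτ).nonempty
  exact IsBlowup.not_stalkIdeal_controlledTransform_le_of_idealOrder_genericPoint_eq P.regW P.regZ P.gen hint hm hτ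
    hx' (stalkIdeal_mono hle x')

end PieceIn

end WeightTwoB

end Summit.ResolutionOfSingularities.ResolutionOfSingularities.Theorems

end
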